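import Summits.QuantumFields.BalabanUV.Beta.SpineRootedS0N
import Summits.QuantumFields.BalabanUV.Beta.SpineRootedSc

/-!
# The ROOTED first-order spine in the NATIVE placement — part B: the composite stencil `ScNAt ρ n` (twin of `SpineRootedSc` WITHOUT `mfNeg`)
# (β sub-cell, row BETA-an2, gen 14; NOTE X-an2-45 / proposed (R45-1); candidate objects BESIDE the existing spine, touching nothing)

HONEST FRAMING (cell charter, verbatim): «discharging BetaPertH makes Balaban's UV stability UNCONDITIONAL — a real
constructive-QFT result; it is NOT the continuum limit and NOT the Clay problem.»  DERIVED cell leaf (pub-balaban β sub-cell, lane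
an2 gen 14); no statement of Bałaban's papers is typed here, no `[cite:]` tag, no `Prop` fact; it instantiates no binder of the
β-function wall by itself.  NOT `BetaPertH`; NOT continuum; NOT Clay.

## What is here (decl-by-decl twin of `SpineRootedSc` §B1, §B2, §B4 with the field–multiplier kernels in an1's NATIVE placement)

`borderIncNAt ρ` (the border increment with `vhSAt ρ` — NO `mfNeg`; the Lagrange increment `lagrIncAt` is placement-free and REUSED by name),
`locStencil_borderIncNAt` (same constant as `locStencil_borderIncAt`), `ScNAt ρ n` (`ScNAt ρ 0 := S0NAt ρ`, then the SAME recursion, unit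
exponents and weights as `ScAt`), `locStencil_ScNAt`, and the block-translation laws `borderIncNAt_translate`, `ScNAt_translate`.
(Parity — `ScNAt` is sgn-ANTIsymmetric — is not needed by the consumers and is left out; `S0NAt`'s is in `SpineRootedS0N`.)

Provenance: b2b-balaban β sub-cell, unit beta-an2 gen 14, 2026-08-20 (v1); over `SpineRootedSc`/`SpineRootedS0N` (an2), `Beta.BalabanCompositeJets`
(an2) and `Beta.AveragingHessianKernelsRooted` (an1) BY NAME; no existing file touched.
-/

open Finset
open scoped BigOperators
open Literature.MathematicalPhysics.QuantumFieldTheory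
open Literature.MathematicalPhysics.QuantumFieldTheory.Balaban1983to89
open Literature.MathematicalPhysics.QuantumFieldTheory.Balaban1983to89.Beta
open LatticeForm (quo proj_add_zsmul)
open BlochFibreUniqueness (quo_add_zsmul)
open B12Sec2to5 (l1 l1_nonneg)
open ExpKernelCalculus (Decays BiLoc VertexFamily VertexFamily₂ shiftK Zl Zl_nonneg l1_sub_triangle l1_sub_symm)
open OneStepResolventKernel (Fib LocStencil JetData KInv decays_KInv shiftK_KInv biLoc_mono biLoc_finset_sum)
open AffineAveraging (Form1 Form2 box toSite)
open StepJetData (wilsonA wBound locStencil_wilsonA wilsonA_translate locStencil_add locStencil_smul biLoc_smul biLoc_weaken l1_add_le)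
open AveragingHessianKernels (ell)
open AveragingHessianKernelsRooted (vhSAt locStencil_vhSAt vhSAt_translate vhSAt_symm hessFFAt biLoc_hessFFAt hessFFAt_translate)
open InterLevelTransport (SLam locStencil_SLam SLam_translate cwsum avgLift biLoc_avgLift avgLift_shiftK)
open BalabanStepJets (lamCoeffOf abs_lamCoeffOf_le lamCoeffOf_translate locStencil_mono vertexFamily₂_mono)
open BalabanCompositeJets (pushSum biLoc_pushSum biLoc_recenter bshift l1_sub_blockBase_le pushSum_translate)

noncomputable section

namespace Summit.QuantumFields.BalabanUV.Beta.SpineRooted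

variable {d : ℕ}

/-! ## §B1♮ The rooted border increment in the native placement -/

section Increments

variable (d)

/-- [folklore] **THE ROOTED BORDER INCREMENT, NATIVE PLACEMENT** (twin of `borderIncAt` WITHOUT `mfNeg`): at the passage from the `M`-fold to
the `(M·Lc)`-fold composite, an1's one-step field–multiplier kernels `vhSAt ρ` on the `M`-lattice pulled back to the fine legs by `avgLift M`. -/
def borderIncNAt (ρ : Fin (d + 1) → ℤ) (Lc M : ℕ) (κ : Fin (d + 1)) (u : Fin (d + 1) → ℤ) : ExpKernelCalculus.MKer (d + 1) (Fib d) :=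
  fun x w a b => ∑ s ∈ Finset.range M, avgLift M (vhSAt ρ d Lc rfl κ (quo M (u - bshift d κ s))) x w a b

variable {d}

/-- [folklore] **THE NATIVE BORDER INCREMENT IS A LOCAL STENCIL FAMILY** (in-block roots), the constant of `locStencil_borderIncAt`. -/
theorem locStencil_borderIncNAt {Lc M : ℕ} [NeZero M] (hLc : 1 ≤ Lc) {r : Fin (d + 1) → ℕ} (hr : r ∈ box (d + 1) Lc) {δ : ℝ}
    (hδ : 0 ≤ δ) :
    LocStencil (borderIncNAt d (toSite r) Lc M)
      (M * (3 * (ell (d + 1) Lc : ℝ) ^ 2 * Real.exp (4 * ((d : ℝ) + 1) * Lc * (M * δ)) * Real.exp (4 * (d + 1) * (M * δ)) *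
        Real.exp (2 * δ * ((d + 2) * M)))) δ := by
  have hM0 : (M : ℝ) ≠ 0 := by exact_mod_cast NeZero.ne M
  have hMδ : 0 ≤ (M : ℝ) * δ := mul_nonneg (Nat.cast_nonneg M) hδ
  intro κ u
  set C0 := 3 * (ell (d + 1) Lc : ℝ) ^ 2 * Real.exp (4 * ((d : ℝ) + 1) * Lc * (M * δ)) * Real.exp (4 * (d + 1) * (M * δ)) with hC0
  have hC0nn : 0 ≤ C0 := by positivity
  have hterm : ∀ s ∈ Finset.range M,
      BiLoc (avgLift M (vhSAt (toSite r) d Lc rfl κ (quo M (u - bshift d κ s)))) u u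
        (C0 * Real.exp (2 * δ * ((d + 2) * M))) δ := by
    intro s hs
    set z := quo M (u - bshift d κ s) with hz
    have hG : BiLoc (vhSAt (toSite r) d Lc rfl κ z) z z
        (3 * (ell (d + 1) Lc : ℝ) ^ 2 * Real.exp (4 * ((d : ℝ) + 1) * Lc * (M * δ))) (M * δ) :=
      locStencil_vhSAt hLc hr hMδ κ z
    have hA := biLoc_avgLift M hG hMδ
    rw [mul_div_cancel_left₀ δ hM0] at hA
    have hR := biLoc_recenter hA hδ u
    refine biLoc_weaken hR ?_ le_rfl
    refine mul_le_mul_of_nonneg_left (Real.exp_le_exp.2 ?_) hC0nn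
    exact mul_le_mul_of_nonneg_left (l1_sub_blockBase_le M u κ (Finset.mem_range.1 hs)) (by positivity)
  have hsum := biLoc_finset_sum (Finset.range M) hterm
  simp only [Finset.sum_const, Finset.card_range, nsmul_eq_mul] at hsum
  exact hsum

end Increments

/-! ## §B2♮ The rooted composite stencil family `ScNAt ρ n` in the native placement -/

section Composite

variable (d) (Lc : ℕ) [NeZero Lc]

/-- [folklore] **THE ROOTED COMPOSITE FIRST-ORDER STENCIL FAMILY, NATIVE PLACEMENT** (twin of `ScAt`): `ScNAt ρ 0 := S0NAt ρ`,
`ScNAt ρ (n+1) κ u := Lc^{d+1} • pushSum (Lc^{n+1}) Lc (ScNAt ρ n κ u) + (cVH·(Lc^{n+1})^{d+2}) • borderIncNAt ρ Lc (Lc^{n+1}) κ u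
  + (cΛ·(Lc^{n+1})^{2d+4}) • lagrIncAt ρ Lc (Lc^{n+1}) (Lc^{n+2}) κ u`. -/
def ScNAt (ρ : Fin (d + 1) → ℤ) (cE cVH cΛ : ℝ) : ℕ → Fin (d + 1) → (Fin (d + 1) → ℤ) → ExpKernelCalculus.MKer (d + 1) (Fib d)
  | 0 => S0NAt d Lc ρ cE cVH cΛ
  | n + 1 => fun κ u =>
      ((Lc : ℝ) ^ (d + 1)) • pushSum (Lc ^ (n + 1)) Lc (ScNAt ρ cE cVH cΛ n κ u) +
        (cVH * ((Lc : ℝ) ^ (n + 1)) ^ (d + 2)) • borderIncNAt d ρ Lc (Lc ^ (n + 1)) κ u +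
        (cΛ * ((Lc : ℝ) ^ (n + 1)) ^ (2 * d + 4)) • lagrIncAt d ρ Lc (Lc ^ (n + 1)) (Lc ^ (n + 2)) κ u

variable {d Lc}

/-- [folklore] Level `0` of `ScNAt` is `S0NAt`. -/
@[simp] theorem ScNAt_zero_level (ρ : Fin (d + 1) → ℤ) (cE cVH cΛ : ℝ) : ScNAt d Lc ρ cE cVH cΛ 0 = S0NAt d Lc ρ cE cVH cΛ := rfl

/-- [folklore] The recursion step (unfolding lemma). -/
theorem ScNAt_succ (ρ : Fin (d + 1) → ℤ) (cE cVH cΛ : ℝ) (n : ℕ) : ScNAt d Lc ρ cE cVH cΛ (n + 1) = fun κ u =>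
    ((Lc : ℝ) ^ (d + 1)) • pushSum (Lc ^ (n + 1)) Lc (ScNAt d Lc ρ cE cVH cΛ n κ u) +
      (cVH * ((Lc : ℝ) ^ (n + 1)) ^ (d + 2)) • borderIncNAt d ρ Lc (Lc ^ (n + 1)) κ u +
      (cΛ * ((Lc : ℝ) ^ (n + 1)) ^ (2 * d + 4)) • lagrIncAt d ρ Lc (Lc ^ (n + 1)) (Lc ^ (n + 2)) κ u := rfl

/-- [folklore] **EVERY NATIVE ROOTED COMPOSITE STENCIL FAMILY IS A LOCAL STENCIL FAMILY** (in-block roots; rate existential per level). -/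
theorem locStencil_ScNAt (hLc : 1 ≤ Lc) {r : Fin (d + 1) → ℕ} (hr : r ∈ box (d + 1) Lc) (cE cVH cΛ : ℝ) :
    ∀ n : ℕ, ∃ Cs δ : ℝ, 0 < δ ∧ LocStencil (ScNAt d Lc (toSite r) cE cVH cΛ n) Cs δ
  | 0 => locStencil_S0NAt hLc hr cE cVH cΛ
  | n + 1 => by
      obtain ⟨Cs, δ, hδ, hloc⟩ := locStencil_ScNAt hLc hr cE cVH cΛ n
      obtain ⟨CL, δL, hδL, hlocL⟩ :=
        locStencil_lagrIncAt (d := d) (Lc := Lc) (M := Lc ^ (n + 1)) (N' := Lc ^ (n + 2)) hLc hr (pow_succ Lc (n + 1))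
      have hCs : 0 ≤ Cs := (hloc 0 0).nonneg (Sum.inl 0)
      have hCL : 0 ≤ CL := (hlocL 0 0).nonneg (Sum.inl 0)
      have h1 : LocStencil (fun κ u => pushSum (Lc ^ (n + 1)) Lc (ScNAt d Lc (toSite r) cE cVH cΛ n κ u))
          (Cs * ((Lc : ℝ) ^ (d + 2)) ^ 2 * Real.exp (4 * (d + 1) * (Lc ^ (n + 1) : ℕ) * Lc * δ)) δ :=
        fun κ u => biLoc_pushSum (M := Lc ^ (n + 1)) hLc (hloc κ u) hδ.le
      have h2 := locStencil_borderIncNAt (d := d) (Lc := Lc) (M := Lc ^ (n + 1)) hLc hr hδ.le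
      have h1' := locStencil_mono h1 ((h1 0 0).nonneg (Sum.inl 0)) (min_le_left δ δL)
      have h2' := locStencil_mono h2 ((h2 0 0).nonneg (Sum.inl 0)) (min_le_left δ δL)
      have h3' := locStencil_mono hlocL hCL (min_le_right δ δL)
      have hfin := locStencil_add (locStencil_add (locStencil_smul ((Lc : ℝ) ^ (d + 1)) h1')
        (locStencil_smul (cVH * ((Lc : ℝ) ^ (n + 1)) ^ (d + 2)) h2'))
        (locStencil_smul (cΛ * ((Lc : ℝ) ^ (n + 1)) ^ (2 * d + 4)) h3')
      exact ⟨_, min δ δL, lt_min hδ hδL, fun κ u => by rw [ScNAt_succ]; exact hfin κ u⟩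

end Composite

/-! ## §B4♮ Block-translation covariance (coarse lattice of the level, all roots) -/

section Translate

variable {Lc : ℕ} [NeZero Lc]

omit [NeZero Lc] in
/-- [folklore] **BLOCK-TRANSLATION COVARIANCE OF THE NATIVE BORDER INCREMENT** under `(M·Lc)•ℤ^{d+1}` (an1's `vhSAt_translate`). -/
theorem borderIncNAt_translate (ρ : Fin (d + 1) → ℤ) (M : ℕ) [NeZero M] (hLc : 1 ≤ Lc) (κ : Fin (d + 1)) (u t : Fin (d + 1) → ℤ) :
    borderIncNAt d ρ Lc M κ (u + ((M * Lc : ℕ) : ℤ) • t) = shiftK (-(((M * Lc : ℕ) : ℤ) • t)) (borderIncNAt d ρ Lc M κ u) := by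
  have e : (M : ℤ) • -((Lc : ℤ) • t) = -(((M * Lc : ℕ) : ℤ) • t) := by rw [smul_neg, smul_smul, Nat.cast_mul]
  funext x w a b
  simp only [borderIncNAt, shiftK]
  refine Finset.sum_congr rfl fun s _ => ?_
  have hq : quo M (u + ((M * Lc : ℕ) : ℤ) • t - bshift d κ s) = quo M (u - bshift d κ s) + (Lc : ℤ) • t := by
    rw [show u + ((M * Lc : ℕ) : ℤ) • t - bshift d κ s = (u - bshift d κ s) + (M : ℤ) • ((Lc : ℤ) • t) by
      rw [smul_smul, ← Nat.cast_mul]; abel, quo_add_zsmul]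
  rw [hq, vhSAt_translate ρ hLc, avgLift_shiftK, e]
  rfl

/-- [folklore] **BLOCK-TRANSLATION COVARIANCE OF THE NATIVE ROOTED COMPOSITE STENCIL FAMILIES** at blocking `Lc^{n+1}` (all roots). -/
theorem ScNAt_translate (ρ : Fin (d + 1) → ℤ) (hLc : 1 ≤ Lc) (cE cVH cΛ : ℝ) : ∀ (n : ℕ) (κ : Fin (d + 1)) (u t : Fin (d + 1) → ℤ),
    ScNAt d Lc ρ cE cVH cΛ n κ (u + (((Lc ^ (n + 1) : ℕ) : ℤ)) • t)
      = shiftK (-((((Lc ^ (n + 1) : ℕ) : ℤ)) • t)) (ScNAt d Lc ρ cE cVH cΛ n κ u)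
  | 0, κ, u, t => by
    rw [ScNAt_zero_level, show ((Lc ^ (0 + 1) : ℕ) : ℤ) = (Lc : ℤ) by rw [zero_add, pow_one]]
    exact S0NAt_translate ρ hLc cE cVH cΛ κ u t
  | n + 1, κ, u, t => by
    have eN : Lc ^ (n + 1 + 1) = Lc ^ (n + 1) * Lc := pow_succ Lc (n + 1)
    have ea : ((Lc ^ (n + 1) : ℕ) : ℤ) • ((Lc : ℤ) • t) = ((Lc ^ (n + 1 + 1) : ℕ) : ℤ) • t := by
      rw [smul_smul, eN, Nat.cast_mul]
    have IH := ScNAt_translate ρ hLc cE cVH cΛ n κ u ((Lc : ℤ) • t)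
    rw [ea] at IH
    have h1 : pushSum (Lc ^ (n + 1)) Lc (ScNAt d Lc ρ cE cVH cΛ n κ (u + ((Lc ^ (n + 1 + 1) : ℕ) : ℤ) • t))
        = shiftK (-(((Lc ^ (n + 1 + 1) : ℕ) : ℤ) • t)) (pushSum (Lc ^ (n + 1)) Lc (ScNAt d Lc ρ cE cVH cΛ n κ u)) := by
      have hp := pushSum_translate (Lc ^ (n + 1)) Lc (ScNAt d Lc ρ cE cVH cΛ n κ u) t
      rw [← eN] at hp
      rw [IH, hp]
    have h2 : borderIncNAt d ρ Lc (Lc ^ (n + 1)) κ (u + ((Lc ^ (n + 1 + 1) : ℕ) : ℤ) • t)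
        = shiftK (-(((Lc ^ (n + 1 + 1) : ℕ) : ℤ) • t)) (borderIncNAt d ρ Lc (Lc ^ (n + 1)) κ u) := by
      have hb := borderIncNAt_translate (Lc := Lc) ρ (Lc ^ (n + 1)) hLc κ u t
      rw [← eN] at hb
      exact hb
    have h3 := lagrIncAt_translate (Lc := Lc) (d := d) ρ (Lc ^ (n + 1)) (Lc ^ (n + 1 + 1)) eN κ u t
    funext x w a b
    rw [ScNAt_succ]
    simp only [Pi.add_apply, Pi.smul_apply, smul_eq_mul]
    rw [h1, h2, h3]
    rfl

end Translate

end Summit.QuantumFields.BalabanUV.Beta.SpineRooted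

end
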